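import Mathlib.NumberTheory.Chebyshev
import Mathlib.Data.Nat.Factorization.Basic
import Mathlib.Tactic
import HarnessLib

/-!
# `lcm(n−k, …, n) = lcm(1, …, n)` for `k ≥ n/2` (CDT Basic Remark 49)

Calegari–Dimitrov–Tang, arXiv:2408.15403, §5 (p. 43), Basic Remark 49: "If `k ≥ n/2`, then
`[1,2,…,n] = [(n−k),…,n]`, because if `p ≤ n` then some multiple of `p` lies in `[n/2, n]`.
Hence `L_{n,k}` does not depend on `k` within this range." (Here `L_{n,k}` is the lowest common
multiple of the consecutive integers `n−k, …, n` of Lemma 48.) The same holds for prime powers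
`q = p^e ≤ n`: either `q ≥ n − k` and `q` itself lies in the range, or the largest multiple of `q`
below `n` exceeds `n − q > n − (n−k) ≥ …`; precisely, writing the range as `[a, b]`, every
`q ≤ b` has a multiple in `[a, b]` as soon as `2a ≤ b + 1`.

* `CalegariDimitrovTang.lcmIcc a b` — `lcm(a, a+1, …, b)` (`= L_{b, b−a}`).
* `CalegariDimitrovTang.exists_multiple_mem_Icc` — every `q ≤ b`, `q ≥ 1`, has a multiple in
  `[a, b]` when `2a ≤ b + 1`.
* `CalegariDimitrovTang.lcmIcc_eq_lcmUpto` — **`lcm(a,…,b) = lcm(1,…,b)`** for `1 ≤ a`,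
  `2a ≤ b + 1` (i.e. `k = b − a ≥ (n−1)/2`, `n = b`).

No named facts.

## References

* [CalegariDimitrovTang2024] arXiv:2408.15403, §5 Basic Remark 49 (p. 43).
-/

namespace Literature.NumberTheory.Transcendental

namespace CalegariDimitrovTang

open Finset

/-- `lcm(a, a+1, …, b)`, the lowest common multiple of the consecutive integers `a, …, b`
(CDT's `L_{n,k}` with `n = b`, `k = b − a`). [cite: CalegariDimitrovTang2024, §5 Lemma 48 (p. 43)] -/
def lcmIcc (a b : ℕ) : ℕ := (Finset.Icc a b).lcm id

/-- `lcmIcc a b ≠ 0` for `1 ≤ a`. [folklore] -/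
theorem lcmIcc_ne_zero {a b : ℕ} (ha : 1 ≤ a) : lcmIcc a b ≠ 0 := by
  unfold lcmIcc
  rw [Ne, Finset.lcm_eq_zero_iff]
  push Not
  intro m hm
  have := (Finset.mem_Icc.mp hm).1
  simp only [id_eq]
  omega

/-- Members of the range divide `lcmIcc`. [folklore] -/
theorem dvd_lcmIcc {a b m : ℕ} (hm : m ∈ Finset.Icc a b) : m ∣ lcmIcc a b :=
  Finset.dvd_lcm hm

/-- **Every `1 ≤ q ≤ b` has a multiple in `[a, b]` when `2a ≤ b + 1`** (for `q ≥ a` take `q`;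
otherwise the largest multiple of `q` below `b` is `> b − q ≥ b − a + 1 ≥ a`).
[cite: CalegariDimitrovTang2024, §5 Basic Remark 49 (p. 43)] -/
theorem exists_multiple_mem_Icc {a b q : ℕ} (hab : 2 * a ≤ b + 1) (hq1 : 1 ≤ q) (hqb : q ≤ b) :
    ∃ c, q ∣ c ∧ c ∈ Finset.Icc a b := by
  by_cases hqa : a ≤ q
  · exact ⟨q, dvd_rfl, Finset.mem_Icc.mpr ⟨hqa, hqb⟩⟩
  · push Not at hqa
    refine ⟨q * (b / q), dvd_mul_right _ _, Finset.mem_Icc.mpr ⟨?_, Nat.mul_div_le b q⟩⟩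
    have h1 : b % q < q := Nat.mod_lt _ (by omega)
    have h2 : q * (b / q) + b % q = b := Nat.div_add_mod b q
    omega

/-- **CDT Basic Remark 49**: `lcm(a, …, b) = lcm(1, …, b)` whenever `1 ≤ a` and `2a ≤ b + 1`
(in CDT's notation: `L_{n,k} = [1,…,n]` for `k ≥ n/2`).
[cite: CalegariDimitrovTang2024, §5 Basic Remark 49 (p. 43)] -/
theorem lcmIcc_eq_lcmUpto {a b : ℕ} (ha : 1 ≤ a) (hab : 2 * a ≤ b + 1) :
    lcmIcc a b = Nat.lcmUpto b := by
  apply Nat.dvd_antisymm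
  · -- `lcm(a..b) ∣ lcm(1..b)`
    unfold lcmIcc
    refine Finset.lcm_dvd fun m hm => ?_
    obtain ⟨hma, hmb⟩ := Finset.mem_Icc.mp hm
    unfold Nat.lcmUpto
    exact Finset.dvd_lcm (Finset.mem_Icc.mpr ⟨by omega, hmb⟩)
  · -- `lcm(1..b) ∣ lcm(a..b)`: every `m ≤ b` divides `lcm(a..b)`, prime power by prime power
    unfold Nat.lcmUpto
    refine Finset.lcm_dvd fun m hm => ?_
    obtain ⟨hm1, hmb⟩ := Finset.mem_Icc.mp hm
    simp only [id_eq]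
    have hm0 : m ≠ 0 := by omega
    have hL0 : lcmIcc a b ≠ 0 := lcmIcc_ne_zero ha
    rw [← Nat.factorization_le_iff_dvd hm0 hL0]
    intro p
    by_cases hp : p.Prime
    · -- the prime power `q = p^{v_p(m)} ≤ m ≤ b` has a multiple `c ∈ [a, b]`, and `c ∣ lcm`
      set v := m.factorization p with hv
      have hqm : p ^ v ∣ m := Nat.ordProj_dvd m p
      have hqle : p ^ v ≤ b := (Nat.le_of_dvd (by omega) hqm).trans hmb
      obtain ⟨c, hqc, hc⟩ := exists_multiple_mem_Icc hab (Nat.one_le_pow _ _ hp.pos) hqle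
      have hc0 : c ≠ 0 := by have := (Finset.mem_Icc.mp hc).1; omega
      have h1 : v ≤ c.factorization p := (hp.pow_dvd_iff_le_factorization hc0).mp hqc
      have h2 : c.factorization p ≤ (lcmIcc a b).factorization p :=
        (Nat.factorization_le_iff_dvd hc0 hL0).mpr (dvd_lcmIcc hc) p
      exact h1.trans h2
    · simp [Nat.factorization_eq_zero_of_not_prime _ hp]

end CalegariDimitrovTang

end Literature.NumberTheory.Transcendental
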